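import Summits.QuantumFields.BalabanUV.T4Continuum.Support.SubtypeCompression
import Summits.QuantumFields.BalabanUV.T4Continuum.Support.KingPairingPlantedLaw

/-!
# T⁴ programme, spine node NE2 (U1a), sub-row Δ1 «NE2⁰-Dirichlet» (T4-DAG `T4-U1a.S-NE2-D1-DIRICHLET°`) — THE REGION TOWER:
# the lineage's free tower (`Δ_a^{(k)}`, King's `Q_L`, the pairing `J_k`) COMPRESSED to the region generated by ONE unit-lattice
# predicate; compatibility of averaging/injection with the region; norms, exact pairing, coercivity, `‖G(Ω)‖ ≤ (d+1)Cst`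

Eleventh generation of the NE2 prover lineage P1 of the cell `pub-balaban` (row NE2 owner), file 4a (uses file 3
`Support/SubtypeCompression`; continued in file 4b `Support/DirichletFreeTower`, which proves the complement law and assembles
`FreeTowerLaws` modulo the injected law).  [Balaban1985BackgroundPropagators] §3 works with propagators restricted to regions: «the
operator Δ_a↾Ω₀ = Ω₀Δ_aΩ₀ … Its inverse is denoted by G» (p. 394, (3.27)).  Tiers A/B of this lineage are the SINGLE-REGION case
(T4-DAG writer's ruling Q-NE2-c1, journal l.12453); this file TYPES the Ω-restricted `U = 1` tower:

 * §1 from a decidable predicate `S₀` on the unit lattice `idx L M 0` (sites × components): the level-`k` region `inReg S₀ k` («the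
   unit block of the site lies in `S₀`», iterated block parents `par`), index types `ridx S₀ k`, the COMPRESSED objects
   `DalevR k = (Δ_a^{(k)})_{ΩΩ}` (Bałaban's `Ω₀Δ_aΩ₀` on `ℓ²(Ω)`), `QlevR k`, `JpcTR k`, and the block-mean projector `PiT k = J_kJ_kᴴ` typed on
   the tower index;
 * §2 COMPATIBILITY: `Q_L` and `J_k = L^{d/2}Q_Lᴴ` never couple a site inside the region to one outside (a fine site and its block parent
   are in or out together), so compression is multiplicative on the tower's products (`SubtypeCompression.toBlock_mul_of_vanish_*`);
 * §3 `‖QlevR k‖² ≤ L^{−d}`, `‖JpcTR k‖ ≤ 1`, the EXACT pairing `√(L^d)·QlevR k·JpcTR k = 1`, COERCIVITY `((d+1)Cst)⁻¹‖v‖² ≤ Re⟨v, Δ_a v⟩`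
   (the `α = none` term of the tree's (1.89)⟹(1.90) inequality `B5Prop11Lower.form_LapOne_le`) and the gradient form bound, hence
   **`isUnit_det_DalevR`** («G(Ω) exists») and **`opNorm_inv_DalevR_le`** `‖G(Ω)‖ ≤ (d+1)Cst` uniformly in level and region, `DalevR` Hermitian.

HONEST FRAMING (T4-DAG p. 1).  `U = 1`; ONE region (no carrier of Bałaban's `{Ω_j}`, no recursive `a_j`); finite torus; linear layer;
operator norm; statements OURS ([folklore] over landed modules; `[cite:]` tags locate SHAPES); NOT [B9] (3.23)–(3.27) as printed;
NE2 (U1a) NOT proved; spine 0/9 unchanged; NOT infinite volume, NOT a mass gap, NOT the Clay problem, NOT summit progress.  HONEST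
DEPENDENCY: continuum YM on T⁴ ⇐ BetaPertH ∧ nine spine estimates (0/9 proved); BetaPertH ⇐ (D1) ∧ (D4) ∧ CAP+tail; G-an2-4 gates asym,
D1 and NE2/3/4.  No `sorry`.
-/

noncomputable section

open scoped BigOperators ComplexConjugate Matrix Matrix.Norms.L2Operator

namespace Summit.QuantumFields.BalabanUV.T4Continuum.DirichletRegionTower

open Literature.MathematicalPhysics.QuantumFieldTheory.Balaban1983to89.B5Prop11Plancherel (Cst Cst_nonneg Tor fine fdiff shiftM
  opNorm_le_of_sq_le)
open Literature.MathematicalPhysics.QuantumFieldTheory.Balaban1983to89.B5Prop11Inverse (calDa calDa_isHermitian)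
open Literature.MathematicalPhysics.QuantumFieldTheory.Balaban1983to89.B5Prop11Lower (nsq nsq_nonneg star_dotProduct_self
  norm_star_dotProduct_le nsq_mulVec_le Vb form_LapOne_le one_le_Cst)
open Literature.MathematicalPhysics.QuantumFieldTheory.Balaban1983to89.B5G183RateTorusW (Qavg off)
open Literature.MathematicalPhysics.QuantumFieldTheory.Balaban1983to89.B5G183RateUnitTower (lev lev_neZero)
open Summit.QuantumFields.BalabanUV.T4Continuum
open Summit.QuantumFields.BalabanUV.T4Continuum.BalabanAveragedTowerUnit (idx Qlev one_le_lev' cast_lev' opNorm_Qlev_sq_le)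
open Summit.QuantumFields.BalabanUV.T4Continuum.BalabanAveragedTowerModes (par eq_par_rem_of_eq)
open Summit.QuantumFields.BalabanUV.T4Continuum.BalabanBlockPoincare (Pi opNorm_one_sub_Pi_mul_le opNorm_shiftM_sub_one_mul_le)
open Summit.QuantumFields.BalabanUV.T4Continuum.KingPairingPlantedLaw (JK JpcT JpcT_eq_JK JK_mul_conjTranspose Pi_conjTranspose
  opNorm_JpcT_le calDalev sqrt_smul_Qlev_mul_JpcT)
open Summit.QuantumFields.BalabanUV.T4Continuum.SubtypeCompression

variable {d : ℕ} (L : ℕ) [NeZero L] (M : Fin d → ℕ) [hM : ∀ μ, NeZero (M μ)]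

/-! ## §1 The region tower generated by a unit-lattice predicate, and the compressed objects -/

/-- MEMBERSHIP AT LEVEL `k` in the region generated by the unit-lattice predicate `S₀`: a level-`(k+1)` site (with its component)
belongs iff its block parent at level `k` does — i.e. iff its unit block lies in `S₀`.  (Bałaban's regions are unions of big blocks;
ONE region, no sequence `{Ω_j}`.) [cite: Balaban1985BackgroundPropagators, p.394 (3.27) (shape: Ω₀ a union of blocks)] [folklore] -/
def inReg (S₀ : idx L M 0 → Prop) : (k : ℕ) → idx L M k → Prop
  | 0 => S₀
  | k + 1 => fun y => inReg S₀ k (par (lev L k) L M y.1, y.2)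

/-- decidability of region membership, level by level. [folklore] -/
instance decInReg (S₀ : idx L M 0 → Prop) [DecidablePred S₀] : (k : ℕ) → DecidablePred (inReg L M S₀ k)
  | 0 => inferInstanceAs (DecidablePred S₀)
  | k + 1 => fun y => decInReg S₀ k (par (lev L k) L M y.1, y.2)

omit [NeZero L] hM in
/-- the recursion, as an `iff`. [folklore] -/
theorem inReg_succ (S₀ : idx L M 0 → Prop) (k : ℕ) (y : idx L M (k + 1)) :
    inReg L M S₀ (k + 1) y ↔ inReg L M S₀ k (par (lev L k) L M y.1, y.2) := Iff.rfl

/-- the INDEX TYPES of the region tower: the level-`k` sites (with components) inside the region. [folklore] -/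
abbrev ridx (S₀ : idx L M 0 → Prop) [DecidablePred S₀] (k : ℕ) : Type := {x : idx L M k // inReg L M S₀ k x}

variable (a : ℝ) (ha : 0 < a) (S₀ : idx L M 0 → Prop) [DecidablePred S₀]

/-- **THE Ω-RESTRICTED FREE OPERATOR** `(Δ_a^{(k)})_{ΩΩ}` — Bałaban's `Ω₀Δ_aΩ₀` read as an operator on `ℓ²(Ω)`.
[cite: Balaban1985BackgroundPropagators, p.394 (3.27) (shape)] [folklore] -/
def DalevR (k : ℕ) : Matrix (ridx L M S₀ k) (ridx L M S₀ k) ℂ :=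
  (calDalev L M a ha k).toBlock (inReg L M S₀ k) (inReg L M S₀ k)

/-- King's one-step block averaging restricted to the region. [cite: King1986, (2.10) p.653 (shape)] [folklore] -/
def QlevR (k : ℕ) : Matrix (ridx L M S₀ k) (ridx L M S₀ (k + 1)) ℂ :=
  (Qlev L M k).toBlock (inReg L M S₀ k) (inReg L M S₀ (k + 1))

/-- King's pairing injection restricted to the region. [cite: King1986, p.664 (convention before Prop. 3.8)] [folklore] -/
def JpcTR (k : ℕ) : Matrix (ridx L M S₀ (k + 1)) (ridx L M S₀ k) ℂ :=
  (JpcT L M k).toBlock (inReg L M S₀ (k + 1)) (inReg L M S₀ k)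

/-- the block-mean projector `Π = J_kJ_kᴴ` TYPED on the tower index `idx (k+1)` (the tree's `PiT L M k`, whose index
`Tor (fine (L·n_k) M) × Fin d` is definitionally `idx (k+1)`). [folklore] -/
def PiT (k : ℕ) : Matrix (idx L M (k + 1)) (idx L M (k + 1)) ℂ := Pi (lev L k) L M

/-- `PiT k` is the tree's projector (definitional). [folklore] -/
theorem PiT_eq (k : ℕ) : PiT L M k = Pi (lev L k) L M := rfl

/-- `J_kJ_kᴴ = Π` on the tower index. [cite: King1986, (2.10) p.653] [folklore] -/
theorem JpcT_mul_conjTranspose (k : ℕ) : JpcT L M k * (JpcT L M k)ᴴ = PiT L M k := JK_mul_conjTranspose (lev L k) L M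

/-- `Πᴴ = Π` on the tower index. [folklore] -/
theorem PiT_conjTranspose (k : ℕ) : (PiT L M k)ᴴ = PiT L M k := Pi_conjTranspose (lev L k) L M

/-! ## §2 Compatibility: averaging and injection never couple the region to its complement -/

omit [NeZero L] in
/-- an entry `Q_{iy}` of King's averaging vanishes unless `i` is the block parent of `y`. [folklore] -/
theorem Qavg_apply_eq_zero {N R : ℕ} [NeZero N] [NeZero R] {i : Tor (fine N M) × Fin d} {y : Tor (fine (R * N) M) × Fin d}
    (h : (par N R M y.1, y.2) ≠ i) : Qavg N R M i y = 0 := by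
  unfold Qavg
  rw [Finset.sum_eq_zero, mul_zero]
  intro j _
  rw [if_neg]
  intro hy
  exact h (eq_par_rem_of_eq N R M hy).1.symm

/-- hence for `Qlev k`. [folklore] -/
theorem Qlev_apply_eq_zero {k : ℕ} {i : idx L M k} {y : idx L M (k + 1)} (h : (par (lev L k) L M y.1, y.2) ≠ i) :
    Qlev L M k i y = 0 :=
  Qavg_apply_eq_zero M h

/-- and for the injection `J_k = L^{d/2}Q_Lᴴ`. [folklore] -/
theorem JpcT_apply_eq_zero {k : ℕ} {i : idx L M k} {y : idx L M (k + 1)} (h : (par (lev L k) L M y.1, y.2) ≠ i) :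
    JpcT L M k y i = 0 := by
  rw [JpcT_eq_JK, JK, Matrix.smul_apply, Matrix.conjTranspose_apply]
  have h0 : Qavg (lev L k) L M i y = 0 := Qavg_apply_eq_zero M h
  rw [h0, star_zero, smul_zero]

omit [DecidablePred S₀] in
/-- `Q` does not couple region rows to non-region columns. [folklore] -/
theorem Qlev_vanish₁ (k : ℕ) : ∀ (i : idx L M k) (y : idx L M (k + 1)),
    inReg L M S₀ k i → ¬ inReg L M S₀ (k + 1) y → Qlev L M k i y = 0 := by
  intro i y hi hy
  by_cases h : (par (lev L k) L M y.1, y.2) = i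
  · exact absurd ((inReg_succ L M S₀ k y).mpr (h ▸ hi)) hy
  · exact Qlev_apply_eq_zero L M h

omit [DecidablePred S₀] in
/-- `Q` does not couple non-region rows to region columns. [folklore] -/
theorem Qlev_vanish₂ (k : ℕ) : ∀ (i : idx L M k) (y : idx L M (k + 1)),
    ¬ inReg L M S₀ k i → inReg L M S₀ (k + 1) y → Qlev L M k i y = 0 := by
  intro i y hi hy
  by_cases h : (par (lev L k) L M y.1, y.2) = i
  · exact absurd (h ▸ (inReg_succ L M S₀ k y).mp hy) hi
  · exact Qlev_apply_eq_zero L M h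

omit [DecidablePred S₀] in
/-- `J` does not couple region rows to non-region columns. [folklore] -/
theorem JpcT_vanish₁ (k : ℕ) : ∀ (y : idx L M (k + 1)) (i : idx L M k),
    inReg L M S₀ (k + 1) y → ¬ inReg L M S₀ k i → JpcT L M k y i = 0 := by
  intro y i hy hi
  by_cases h : (par (lev L k) L M y.1, y.2) = i
  · exact absurd (h ▸ (inReg_succ L M S₀ k y).mp hy) hi
  · exact JpcT_apply_eq_zero L M h

omit [DecidablePred S₀] in
/-- `J` does not couple non-region rows to region columns. [folklore] -/
theorem JpcT_vanish₂ (k : ℕ) : ∀ (y : idx L M (k + 1)) (i : idx L M k),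
    ¬ inReg L M S₀ (k + 1) y → inReg L M S₀ k i → JpcT L M k y i = 0 := by
  intro y i hy hi
  by_cases h : (par (lev L k) L M y.1, y.2) = i
  · exact absurd ((inReg_succ L M S₀ k y).mpr (h ▸ hi)) hy
  · exact JpcT_apply_eq_zero L M h

/-! ## §3 The transferred fields of `FreeTowerLaws` -/

/-- `‖QlevR k‖² ≤ L^{−d}`. [folklore] -/
theorem opNorm_QlevR_sq_le (k : ℕ) : ‖QlevR L M S₀ k‖ ^ 2 ≤ ((L : ℝ) ^ d)⁻¹ :=
  (pow_le_pow_left₀ (norm_nonneg _) (opNorm_toBlock_le _ _ _) 2).trans (opNorm_Qlev_sq_le L M k)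

/-- `‖JpcTR k‖ ≤ 1`. [folklore] -/
theorem opNorm_JpcTR_le (k : ℕ) : ‖JpcTR L M S₀ k‖ ≤ 1 :=
  (opNorm_toBlock_le _ _ _).trans (opNorm_JpcT_le L M k)

/-- compression is multiplicative on `Q_k·J_k`. [folklore] -/
theorem QlevR_mul_JpcTR (k : ℕ) :
    QlevR L M S₀ k * JpcTR L M S₀ k = (Qlev L M k * JpcT L M k).toBlock (inReg L M S₀ k) (inReg L M S₀ k) :=
  (toBlock_mul_of_vanish_left _ _ _ _ _ (Qlev_vanish₁ L M S₀ k)).symm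

/-- **THE EXACT PAIRING SURVIVES**: `√(L^d)·QlevR k·JpcTR k = 1 + 0`. [cite: King1986, (2.10) p.653] [folklore] -/
theorem sqrt_smul_QlevR_mul_JpcTR (k : ℕ) :
    ((((Real.sqrt ((L : ℝ) ^ d)) : ℝ) : ℂ)) • (QlevR L M S₀ k * JpcTR L M S₀ k) = 1 + 0 := by
  rw [QlevR_mul_JpcTR, ← toBlock_smul, sqrt_smul_Qlev_mul_JpcT, add_zero, toBlock_one, add_zero]

/-- the coercivity constant `γ_D = ((d+1)·Cst(d,a))⁻¹` of Bałaban's `Δ_a` (from the tree's (1.89)⟹(1.90) inequality). [folklore] -/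
def gamD (d : ℕ) (a : ℝ) : ℝ := (((d : ℝ) + 1) * Cst d a)⁻¹

/-- `(d+1)·Cst > 0`. [folklore] -/
theorem K_pos : 0 < ((d : ℝ) + 1) * Cst d a :=
  mul_pos (by positivity) (lt_of_lt_of_le one_pos (one_le_Cst (d := d) (a := a)))

/-- `γ_D > 0`. [folklore] -/
theorem gamD_pos : 0 < gamD d a := inv_pos.mpr (K_pos a)

/-- **COERCIVITY OF `Δ_a`**: `γ_D·‖v‖² ≤ Re⟨v, Δ_a v⟩` on every torus (the `α = none` term of `form_LapOne_le`).
[cite: Balaban1984PropagatorsI, Prop. 1.1 (1.90) p.33 (kernel version of the tree, constant ours)] [folklore] -/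
theorem coercive_calDa (n : ℕ) [NeZero n] (hn : 1 ≤ n) : Coercive (calDa n hn M a ha) (gamD d a) := by
  intro v
  have h := form_LapOne_le n hn M a ha v
  have h1 : nsq v ≤ ∑ α, nsq (Vb n M α *ᵥ v) := by
    have := Finset.single_le_sum (f := fun α => nsq (Vb n M α *ᵥ v)) (fun α _ => nsq_nonneg _) (Finset.mem_univ none)
    simpa only [Vb, Matrix.one_mulVec] using this
  unfold gamD
  rw [inv_mul_le_iff₀ (K_pos a)]
  exact h1.trans h

/-- the lattice gradients are controlled by the same form: `‖∇_ν v‖² ≤ (d+1)Cst·Re⟨v, Δ_a v⟩`. [folklore] -/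
theorem nsq_fdiff_le_form (n : ℕ) [NeZero n] (hn : 1 ≤ n) (ν : Fin d) (v : Tor (fine n M) × Fin d → ℂ) :
    nsq (fdiff (fine n M) (n : ℂ) ν *ᵥ v) ≤ ((d : ℝ) + 1) * Cst d a * (star v ⬝ᵥ (calDa n hn M a ha *ᵥ v)).re := by
  have h := form_LapOne_le n hn M a ha v
  have h1 : nsq (fdiff (fine n M) (n : ℂ) ν *ᵥ v) ≤ ∑ α, nsq (Vb n M α *ᵥ v) := by
    have := Finset.single_le_sum (f := fun α => nsq (Vb n M α *ᵥ v)) (fun α _ => nsq_nonneg _) (Finset.mem_univ (some ν))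
    simpa only [Vb] using this
  exact h1.trans h

/-- coercivity of every level operator `Δ_a^{(k)}`. [folklore] -/
theorem coercive_calDalev (k : ℕ) : Coercive (calDalev L M a ha k) (gamD d a) :=
  coercive_calDa M a ha (lev L k) (one_le_lev' L k)

/-- **`(Δ_a^{(k)})_{ΩΩ}` IS INVERTIBLE** («G(Ω) exists»). [cite: Balaban1985BackgroundPropagators, p.394 (3.27) (shape)] [folklore] -/
theorem isUnit_det_DalevR (k : ℕ) : IsUnit (DalevR L M a ha S₀ k).det :=
  isUnit_det_toBlock_of_coercive _ (gamD_pos a) (coercive_calDalev L M a ha k)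

/-- **`‖G(Ω)‖ ≤ (d+1)Cst`** uniformly in the level and the region. [folklore] -/
theorem opNorm_inv_DalevR_le (k : ℕ) : ‖(DalevR L M a ha S₀ k)⁻¹‖ ≤ ((d : ℝ) + 1) * Cst d a := by
  have h := opNorm_inv_toBlock_le_of_coercive (inReg L M S₀ k) (gamD_pos a) (coercive_calDalev L M a ha k)
  rwa [gamD, inv_inv] at h

/-- `(Δ_a^{(k)})_{ΩΩ}` is Hermitian. [folklore] -/
theorem DalevR_isHermitian (k : ℕ) : (DalevR L M a ha S₀ k).IsHermitian := by
  unfold DalevR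
  have h := calDa_isHermitian (lev L k) (one_le_lev' L k) M a ha
  show ((calDalev L M a ha k).toBlock (inReg L M S₀ k) (inReg L M S₀ k))ᴴ = _
  rw [toBlock_conjTranspose]
  exact congrArg (fun X => Matrix.toBlock X (inReg L M S₀ k) (inReg L M S₀ k)) h

end Summit.QuantumFields.BalabanUV.T4Continuum.DirichletRegionTower

end
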